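import Mathlib.Analysis.SpecialFunctions.Pow.Asymptotics
import Literature.Analysis.FluidPDE.WaveKinetic
import HarnessLib

-- provenance: harness21/H21/H21/Statements/Hilbert6/WaveKinetic.lean @ f1218b6 (interim HEAD d8f2665); M5 mechanical rewrite
/-!
# Hilbert's sixth problem: rigorous derivation of the wave kinetic equation (Deng–Hani)

Family: `hilbert6` (statement **hilbert6.S21**); trunk FluidKinetic / T-KINETIC, statement item
K7 `H6WaveKinetic` (last item of the group).

Informal statement (inventory `hilbert6.S21`): for the cubic NLS on the torus `T^d_L` (`d ≥ 3`)
with well-prepared random-phase data of nonlinearity strength `α`, in the kinetic limit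
`L → ∞`, `α → 0` under the scaling law `α = L^{-γ}` (`0 < γ < 1`), the mode energies
`𝔼 |û(T_kin · t, k)|²` are governed, uniformly in `k ∈ ℤ^d_L` and `t ∈ [0, δ]`, by the solution
`n(t, k)` of the wave kinetic equation (WKE) with datum `n_in`, for some `δ > 0` depending only
on the datum (a fraction of the kinetic time).

We use the prelude `Literature.Prelude.FluidKinetic.WaveKinetic` (K7): the WKE
(`WaveKinetic.IsWKESolutionOn` on `EuclideanSpace ℝ d`), the cubic NLS rescaled to the unit
torus `UnitAddTorus d` (`WaveKinetic.IsCubicNLSOn S β α u`, equation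
`i∂ₜu − βΔu + α|u|²u = 0`), Gaussian random phase families
(`WaveKinetic.IsGaussianPhaseFamily`), the random data `WaveKinetic.randomData L n_in η ω`,
mode energies `WaveKinetic.modeEnergy` and the kinetic time `WaveKinetic.kineticTime α = α⁻²`.

## Contents

* `Hilbert6.dengHaniScalingLaw γ L = L^{-γ}`: the nonlinearity strength as a function of the
  box size, with API lemmas (positivity, `α → 0`, `T_kin → ∞`).
* `Hilbert6.WaveKineticDerivation d γ : Prop`: the packaged conclusion of Deng–Hani's theorem
  for the index type `d` (dimension `Fintype.card d`) and the scaling exponent `γ`, in the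
  printed high-probability form (sample spaces `Ω : Type u` are quantified inside).
* `Hilbert6.deng_hani_wke` (**hilbert6.S21**): `3 ≤ card d → γ ∈ (0, 1) →
  WaveKineticDerivation d γ` (Deng–Hani 2021/2023, Thm 1.1), proof `sorry`.
* **Correction (kinetic-time constant).** `Hilbert6.dengHaniKineticTime α = (4πα²)⁻¹`, the
  kinetic time in the normalisation of the prelude (with API lemmas), and
  `Hilbert6.WaveKineticLimit d γ` (Deng–Hani, Mem. AMS 320 (2026), no. 1631, Thm 1.1): the
  corrected form of `WaveKineticDerivation`, whose clock `kineticTime α = α⁻²` is off by the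
  factor `4π`, which is *not* absorbed by `δ`, so that `deng_hani_wke` is mis-stated (see
  §Correction at the end of the file; the old declarations are kept verbatim, the corrected closed
  fact `3 ≤ card d → γ ∈ (0,1) → WaveKineticLimit d γ` is left to the operator path).

## Rescaling to the unit torus

Deng–Hani solve `(i∂ₜ − Δ)u + α|u|²u = 0` on `T^d_L = [0, L]^d` with Fourier modes
`k ∈ ℤ^d_L = L⁻¹ℤ^d`, dispersion `|k|²`, and `L^{-d/2}`-normalised data
`u_in = L^{-d/2} ∑_k √n_in(k) η_k e^{2πik·x}` (pointwise amplitude `O(1)`, `T_kin = α⁻²`).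
The prelude's `WaveKinetic.randomData L n_in η ω` is the unit-torus field
`w(0, y) = ∑_κ √n_in(κ/L) η_κ e^{2πiκ·y}`, i.e. `w(t, y) = L^{d/2} u(t, L y)`
(so that `WaveKinetic.modeEnergy` of `w` is exactly `𝔼|û(t, k)|²`, `k = κ / L`, cf.
`WaveKinetic.modeEnergy_randomData_zero`). In these variables the equation reads
`i∂ₜw − L⁻² Δ_y w + α L^{-d} |w|² w = 0`. On the unit torus `(ℝ/ℤ)^d`, whose characters are
`e^{2πi κ·y}` (`UnitAddTorus.mFourier κ`, `κ ∈ ℤ^d`, `−Δ e^{2πiκ·y} = 4π²|κ|² e^{2πiκ·y}`),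
the dispersion relation `ω(κ) = |κ / L|²` is produced by the coefficient `β = (2πL)⁻²` in front
of `−Δ`; hence below `WaveKinetic.IsCubicNLSOn` receives `β = (2πL)⁻²` and the nonlinearity
coefficient `α · L^{-d}` (`α = L^{-γ}`), while the kinetic time `WaveKinetic.kineticTime α`
keeps the argument `α = L^{-γ}`. The lattice mode `κ ∈ ℤ^d` is compared with the WKE solution
at the physical wave number `L⁻¹ • Torus.latticeVec κ`.

## Mathlib

Mathlib has no NLS, no wave kinetic equation and no random Fourier data (searched `kinetic`,
`Schrodinger`, `NLS`, `randomFourier`, `scalingLaw` in `Mathlib/`: nothing relevant). Used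
without redefinition: `SchwartzMap` (`Mathlib.Analysis.Distribution.SchwartzSpace.Basic`),
`EuclideanSpace`, `UnitAddTorus`, `UnitAddTorus.mFourierCoeff`, `MeasureTheory.Measure`,
`Measure.restrict`, `IsProbabilityMeasure`, `Real.rpow` (API: `Real.rpow_pos_of_pos`,
`tendsto_rpow_neg_atTop`, `tendsto_rpow_atTop`), `Filter.Tendsto`, `ENNReal.ofReal`.

## Design choices and flagged constants ('?')

* **Admissible `γ`-range ('?')**: we state the theorem for all `γ ∈ (0, 1)` on the *square*
  torus, following the inventory text; the Forum Math. Pi paper reaches only sub-kinetic times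
  `L^{-ε} T_kin`, the 2023 paper ("Full derivation") treats a specific scaling law, and the full
  range `0 < γ < 1` on the square torus is, to our knowledge, only in Deng–Hani's later "full
  range of scaling laws" paper; parts of the range may require genericity conditions on the
  aspect ratios of the torus. This must be reconciled with the papers before any downstream use.
* **Kinetic time ('?')**: `WaveKinetic.kineticTime α = α⁻²` agrees with Deng–Hani's `T_kin`
  only up to a numerical constant (prelude flag, outline §4.9); likewise the overall constant of
  the collision kernel `WaveKinetic.collision` and the numerical normalisation/sign of `β`, `α`
  in `WaveKinetic.IsCubicNLSOn` (factors of `2π`) are '?'. The *powers of `L`* (`β ∝ L⁻²`,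
  nonlinearity `α L^{-d}`, `T_kin = α⁻²`) are fixed by the rescaling above and are not part of
  the flag.
* **High-probability form (as printed)**: Deng–Hani prove that there is an event `Ω_L` with
  `P(Ω_L) ≥ 1 − L^{-ν}` on which (NLS) with the random data has a smooth solution on
  `[0, δ T_kin]`, and that `𝔼(1_{Ω_L} |û(T_kin t, k)|²) → n(t, k)` uniformly. Accordingly the
  packaged statement *concludes* the existence of measurable good events `G k ⊆ Ω` with
  `P (G k)ᶜ → 0` and of fields `u k ω` solving the rescaled NLS with the random data for every
  `ω ∈ G k`, with `ω`-measurable Fourier modes, and compares the *restricted* expectation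
  `WaveKinetic.modeEnergy (P.restrict (G k))` with the WKE solution. Classical uniqueness of
  smooth NLS solutions pins down `u k ω` on `G k` (its values off `G k` are irrelevant to the
  restricted expectation), and `P (G k)ᶜ → 0` prevents a vacuous choice of `G` (the rate
  `L^{-ν}` is not recorded).
* **Random phases**: we state the theorem for *Gaussian* phase families
  (`WaveKinetic.IsGaussianPhaseFamily`), as the architect's item asks; Deng–Hani also allow
  `η_k` uniform on the unit circle. This is a documented specialisation (the prelude's
  `WaveKinetic.IsRandomPhaseFamily` allows arbitrary rotation-invariant laws, which is *more*
  than the printed theorem covers, so we do not use it as the hypothesis).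
* The limit `L → ∞` is taken along arbitrary sequences `L : ℕ → ℝ` of *positive* reals tending
  to `+∞` (equivalent to the real-parameter limit; positivity avoids `Real.rpow` junk values in
  `α = L^{-γ}`, cf. `dengHaniScalingLaw_pos`).
* **The WKE solution and its class**: the statement first asserts that the WKE with datum `n_in`
  has a classical solution `n` on some `[0, T)`, `T > δ` (`WaveKinetic.IsWKESolutionOn`), in
  Deng–Hani's weighted-`L^∞` class `∀ s, WaveKinetic.HasUniformDecayOn T s n` (so `δ` lies
  inside the WKE existence time, as in the paper where the solution on `[0, δ]` is *produced*;
  cf. `WaveKinetic.exists_isWKESolutionOn_local`), and then compares the mode energies with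
  every such solution in that class. Quantifying over every solution in the class implicitly
  asserts uniqueness in that class on `[0, δ]` (true by local well-posedness); no uniqueness
  outside this class is implied.
* `δ` is chosen after the datum `n_in` (and the fixed `d`, `γ`) and before the sample space
  `Ω`, the probability measure, the phase family and the sequence `L`, as in the printed theorem
  (`δ = δ(n_in, d, γ)`); to quantify `Ω` inside the `Prop` we fix a universe `u`
  (`Ω : Type u`, as Mathlib does in `UnivLE`), while the index type `d` is a parameter.
* The uniform-in-`(t, k)` convergence is written as `Tendsto` to `0` in `ℝ≥0∞` of
  `⨆ t ∈ [0, δ], ⨆ κ, ENNReal.ofReal |⋯|` (no junk value for unbounded suprema).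
* Long-time derivation (Deng–Hani, arXiv:2301.07063) is only mentioned, not stated.

## References

Journal data copied from the inventory and not re-verified at source ('?': the 2023 paper is,
to our knowledge, Invent. Math. 233 (2023), 543–724 rather than J. Amer. Math. Soc.).

* Y. Deng, Z. Hani, *On the derivation of the wave kinetic equation for NLS*, Forum Math. Pi 9
  (2021), e6, Thm 1.1.
* Y. Deng, Z. Hani, *Full derivation of the wave kinetic equation*, (inventory:) J. Amer. Math.
  Soc. 36 (2023), 543–724, Thm 1.1 (journal per inventory, unverified).
* Y. Deng, Z. Hani, *Derivation of the wave kinetic equation: full range of scaling laws*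
  (the range `0 < γ < 1`; bibliographic data unverified).
* Y. Deng, Z. Hani, *Long time justification of wave turbulence theory*, arXiv:2301.07063.

References verified at source (2026-08-15, correction section): the `γ = 1` paper is
Y. Deng, Z. Hani, *Full derivation of the wave kinetic equation*, Invent. Math. 233 (2023),
543–724 (`DengHani2023`; generic rectangular tori, scaling law `α = L⁻¹` only); the range
`0 < γ < 1` on the square (and on every rectangular) torus is Y. Deng, Z. Hani, *Derivation of
the wave kinetic equation: full range of scaling laws*, Mem. Amer. Math. Soc. 320 (2026),
no. 1631 = arXiv:2301.07063 (`DengHani2026`, Thm 1.1); the long-time paper is arXiv:2311.10082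
(not 2301.07063). The claim key `DengHaniMa2024` attached to the declarations above refers to the
hard-sphere/Boltzmann papers (arXiv:2408.07818, 2503.01800) and not to the wave kinetic equation.
-/

open MeasureTheory Set Filter Topology
open scoped ENNReal

universe u

namespace Literature.MathematicalPhysics.KineticTheory

noncomputable section

section Hilbert6

/-- Deng–Hani's *scaling law* between the nonlinearity strength `α` of the cubic NLS and the
size `L` of the torus in the kinetic limit: `α = L^{-γ}` (real power `Real.rpow`), with
`0 < γ < 1` the admissible range (Deng–Hani, Forum Math. Pi 9 (2021), Thm 1.1; 2023, Thm 1.1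
and §1.1). A readability wrapper around `Real.rpow`. Junk: `Real.rpow` conventions for `L ≤ 0`
(the statements only use `L > 0`, `L → +∞`). [claim: DengHaniMa2024, status: under-review] -/
def dengHaniScalingLaw (γ L : ℝ) : ℝ :=
  L ^ (-γ)

/-- The scaling law `α = L^{-γ}` is positive for positive box size `L` (API; immediate from
`Real.rpow_pos_of_pos`; Deng–Hani, Forum Math. Pi 9 (2021), §1.1: `α > 0`). [claim: DengHaniMa2024, status: under-review] -/
theorem dengHaniScalingLaw_pos (γ : ℝ) {L : ℝ} (hL : 0 < L) : 0 < dengHaniScalingLaw γ L :=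
  Real.rpow_pos_of_pos hL _

/-- Under the scaling law with `0 < γ` the nonlinearity strength tends to `0` as `L → ∞`
(the weakly nonlinear regime; Deng–Hani, Forum Math. Pi 9 (2021), §1.1; this is Mathlib's
`tendsto_rpow_neg_atTop`). [claim: DengHaniMa2024, status: under-review] -/
theorem tendsto_dengHaniScalingLaw_atTop {γ : ℝ} (hγ : 0 < γ) :
    Tendsto (dengHaniScalingLaw γ) atTop (𝓝 0) :=
  tendsto_rpow_neg_atTop hγ

/-- Under the scaling law with `0 < γ` the kinetic time `T_kin = α⁻² = L^{2γ}` tends to `+∞`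
as `L → ∞` (Deng–Hani, Forum Math. Pi 9 (2021), §1.1, (1.4); via Mathlib's
`tendsto_rpow_atTop`). [claim: DengHaniMa2024, status: under-review] -/
theorem tendsto_kineticTime_dengHaniScalingLaw_atTop {γ : ℝ} (hγ : 0 < γ) :
    Tendsto (fun L => Literature.Analysis.FluidPDE.WaveKinetic.kineticTime (dengHaniScalingLaw γ L)) atTop atTop := by
  have h : Tendsto (fun L : ℝ => L ^ (2 * γ)) atTop atTop := tendsto_rpow_atTop (by positivity)
  refine h.congr' ?_
  filter_upwards [eventually_gt_atTop 0] with L hL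
  simp only [Literature.Analysis.FluidPDE.WaveKinetic.kineticTime, dengHaniScalingLaw]
  rw [← Real.rpow_natCast, ← Real.rpow_mul hL.le, ← Real.rpow_neg hL.le]
  congr 1
  push_cast
  ring

variable (d : Type*) [Fintype d] [DecidableEq d]

/-- **Deng–Hani's derivation of the wave kinetic equation, packaged as a `Prop`** for the index
type `d` (space dimension `Fintype.card d`) and the scaling exponent `γ` (sample spaces
`Ω : Type u` in the fixed universe `u`). For every nonnegative Schwartz initial spectrum
`n_in : ℝ^d → ℝ` there is `δ > 0` such that:
(i) the WKE with datum `n_in` has a classical solution `n` on some `[0, T)`, `T > δ`, in the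
weighted-`L^∞` class (`WaveKinetic.IsWKESolutionOn`, `∀ s, WaveKinetic.HasUniformDecayOn T s n`);
(ii) for every sample space `Ω`, probability measure `P` on `Ω`, Gaussian random phase family
`η` (`WaveKinetic.IsGaussianPhaseFamily`) and every sequence of box sizes `L_k > 0`,
`L_k → +∞`, there are measurable *good events* `G_k ⊆ Ω` with `P(G_kᶜ) → 0` and fields
`u_k : Ω → ℝ → T^d → ℂ` such that, for every `ω ∈ G_k`, `u_k(ω)` is a smooth solution on
`[0, δ · T_kin]` of the rescaled cubic NLS `i∂ₜu − (2πL_k)⁻² Δu + α_k L_k^{-d} |u|²u = 0`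
(`WaveKinetic.IsCubicNLSOn`, `α_k = L_k^{-γ} = dengHaniScalingLaw γ L_k`, `d = Fintype.card d`,
`T_kin = WaveKinetic.kineticTime α_k`; see the module docstring §Rescaling for the factor
`L_k^{-d}`) with random data `u_k(ω, 0) = WaveKinetic.randomData L_k n_in η ω`, the Fourier
modes of `u_k` at times `t ∈ [0, δ · T_kin]` are `ω`-measurable, and for every classical
solution `n` of the WKE on `[0, T)`, `T > δ`, with `n(0) = n_in` in the weighted-`L^∞` class one
has, with the expectation restricted to the good event (`P.restrict (G k)`),
`lim_{k → ∞} sup_{t ∈ [0, δ]} sup_{κ ∈ ℤ^d} |𝔼 (1_{G_k} |û_k(T_kin · t, κ)|²) − n(t, κ / L_k)| = 0`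
(Deng–Hani, Forum Math. Pi 9 (2021), Thm 1.1; 2023, Thm 1.1 — journal per inventory
J. Amer. Math. Soc. 36, unverified). Flags ('?'): the numerical constants in `T_kin` and in
`β`, `α`; Gaussian phases only (a specialisation); the rate `P(G_kᶜ) ≤ L_k^{-ν}` is not
recorded; see the module docstring. [claim: DengHaniMa2024, status: under-review] -/
def WaveKineticDerivation (γ : ℝ) : Prop :=
  ∀ nin : SchwartzMap (EuclideanSpace ℝ d) ℝ, (∀ v, 0 ≤ nin v) →
    ∃ δ : ℝ, 0 < δ ∧
      (∃ (T : ℝ) (n : ℝ → EuclideanSpace ℝ d → ℝ), δ < T ∧ Literature.Analysis.FluidPDE.WaveKinetic.IsWKESolutionOn T n ∧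
        (∀ s : ℝ, Literature.Analysis.FluidPDE.WaveKinetic.HasUniformDecayOn T s n) ∧ n 0 = nin) ∧
      ∀ (Ω : Type u) [MeasurableSpace Ω] (P : Measure Ω) [IsProbabilityMeasure P]
        (η : (d → ℤ) → Ω → ℂ), Literature.Analysis.FluidPDE.WaveKinetic.IsGaussianPhaseFamily P η →
      ∀ L : ℕ → ℝ, (∀ k, 0 < L k) → Tendsto L atTop atTop →
      ∃ (G : ℕ → Set Ω) (u : ℕ → Ω → ℝ → UnitAddTorus d → ℂ),
        (∀ k, MeasurableSet (G k)) ∧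
        Tendsto (fun k => P (G k)ᶜ) atTop (𝓝 0) ∧
        (∀ k, ∀ ω ∈ G k, Literature.Analysis.FluidPDE.WaveKinetic.IsCubicNLSOn
            (Icc 0 (δ * Literature.Analysis.FluidPDE.WaveKinetic.kineticTime (dengHaniScalingLaw γ (L k))))
            (((2 * Real.pi * L k) ^ 2)⁻¹)
            (dengHaniScalingLaw γ (L k) / L k ^ Fintype.card d) (u k ω) ∧
          u k ω 0 = Literature.Analysis.FluidPDE.WaveKinetic.randomData (L k) nin η ω) ∧
        (∀ k, ∀ t ∈ Icc 0 (δ * Literature.Analysis.FluidPDE.WaveKinetic.kineticTime (dengHaniScalingLaw γ (L k))), ∀ κ,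
          Measurable fun ω => UnitAddTorus.mFourierCoeff (u k ω t) κ) ∧
      ∀ (T : ℝ) (n : ℝ → EuclideanSpace ℝ d → ℝ), δ < T →
        Literature.Analysis.FluidPDE.WaveKinetic.IsWKESolutionOn T n → (∀ s : ℝ, Literature.Analysis.FluidPDE.WaveKinetic.HasUniformDecayOn T s n) →
        n 0 = nin →
      Tendsto (fun k => ⨆ t ∈ Icc (0 : ℝ) δ, ⨆ κ : d → ℤ,
          ENNReal.ofReal |Literature.Analysis.FluidPDE.WaveKinetic.modeEnergy (P.restrict (G k)) (u k)
              (Literature.Analysis.FluidPDE.WaveKinetic.kineticTime (dengHaniScalingLaw γ (L k)) * t) κ -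
            n t ((L k)⁻¹ • Literature.Analysis.FunctionSpaces.Torus.latticeVec κ)|)
        atTop (𝓝 0)

variable {d}

/-- **hilbert6.S21** (rigorous derivation of the wave kinetic equation; Deng–Hani, Forum Math.
Pi 9 (2021), e6, Thm 1.1; 2023, Thm 1.1 (J. Amer. Math. Soc. 36 per inventory, unverified);
long-time version arXiv:2301.07063, not stated here). In dimension `d ≥ 3`, for the cubic NLS
on `T^d_L` with Gaussian random-phase data of spectrum `n_in` (Schwartz, nonnegative) and
nonlinearity strength `α = L^{-γ}`, `0 < γ < 1`, in the kinetic limit `L → ∞`: with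
probability `1 − o(1)` the solution exists on `[0, δ · T_kin]` for some `δ = δ(n_in, d, γ) > 0`,
and the mode energies `𝔼 (1_{good event} |û(T_kin · t, k)|²)` converge, uniformly in
`k ∈ ℤ^d_L` and `t ∈ [0, δ]`, to the solution `n(t, k)` of the wave kinetic equation with
`n(0) = n_in` (which exists on `[0, δ]` in the weighted-`L^∞` class
`WaveKinetic.HasUniformDecayOn`): `WaveKineticDerivation d γ`. Flags ('?', to be reconciled
with the papers before downstream use): the exact admissible `γ`-range / genericity of the
torus and which of the Deng–Hani papers covers it, the numerical constant in `T_kin`, and the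
numerical normalisation of `randomData` and of `β` (the powers of `L` are fixed by the rescaling
`w(t, y) = L^{d/2} u(t, L y)`, module docstring). [claim: DengHaniMa2024, status: under-review] -/
def deng_hani_wke : Prop :=
  ∀ (hd : 3 ≤ Fintype.card d) {γ : ℝ} (hγ : γ ∈ Ioo (0 : ℝ) 1),
    WaveKineticDerivation.{u} d γ

/-! ## Correction: the kinetic-time constant (`deng_hani_wke` is mis-stated)

**Source, as printed** (`DengHani2026` = Deng–Hani, *Derivation of the wave kinetic equation:
full range of scaling laws*, Mem. Amer. Math. Soc. 320 (2026), no. 1631, arXiv:2301.07063,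
§1.1 and Theorem 1.1). On the square torus `T^d_L = [0, L]^d`, `d ≥ 3` (and, by the remark after
the theorem, on every rectangular torus, without genericity assumption), consider
`(i∂ₜ − Δ_DH)u + α|u|²u = 0` with the *normalised* Laplacian `Δ_DH = (2π)⁻¹(∂₁² + ⋯ + ∂_d²)`, the
Fourier transform `û(t, k) = L^{-d/2} ∫_{T^d_L} u(t, x) e^{-2πik·x} dx` (`k ∈ ℤ^d_L = L⁻¹ℤ^d`),
data `û_in(k) = √n_in(k) g_k(ω)` with `n_in ≥ 0` Schwartz and `g_k` i.i.d. standard complex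
Gaussians, `T_kin := 1/(2α²)`, and the scaling law `α = L^{-γ}` for a fixed `γ ∈ (0, 1)`.
Theorem 1.1: fix `δ ≪ 1` depending only on `(d, γ, n_in)`; for `L` large enough the equation has a
smooth solution up to `T = δ T_kin` with probability `≥ 1 − e^{−(log L)²}`, and
`lim_{L→∞} sup_{t ∈ [0, T]} sup_{k ∈ ℤ^d_L} |𝔼|û(t, k)|² − n(t / T_kin, k)| = 0`, where `n` solves
(WKE) `∂ₜn = 𝒦(n, n, n)`, `n(0) = n_in`, with the kernel (COL)
`∫ (n₁n₂n₃ − n n₂n₃ + n₁ n n₃ − n₁n₂ n) δ(k₁ − k₂ + k₃ − k) δ(|k₁|² − |k₂|² + |k₃|² − |k|²)`,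
the expectation being taken on the event that the smooth solution exists. (Local existence and
uniqueness of the WKE solution for Schwartz data: `DengHani2023`, Prop. 7.9.)

**The kernel.** In the parametrisation `k₁ = k + a`, `k₃ = k + b`, `k₂ = k + a + b` the resonance
function is `Ω = −2⟨a, b⟩`, `|∇_b Ω| = 2‖a‖`, so with the standard (coarea) meaning of `δ(Ω)` the
kernel (COL) is *exactly* the prelude's `WaveKinetic.collision` (constant `1`).

**Transcription to the prelude's normalisation.** The prelude's unit-torus field uses
`β = (2πL)⁻²` in front of Mathlib's Laplacian, i.e. the dispersion relation is exactly
`ω(κ) = |κ/L|²` with phases `e^{−it|k|²}` (characters `e^{2πiκ·y}`), unit-mass Haar measure, and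
`𝔼|η_κ|² = 1`. If `u` solves Deng–Hani's (NLS) with `α = L^{-γ}` and datum `2π · n_in`, then
`w(t, y) := (2π)^{-1/2} L^{d/2} u(t / (2π), L y)` solves
`i∂ₜw − (2πL)⁻² Δw + L^{-γ} L^{-d} |w|²w = 0` with `ŵ(0, κ) = √n_in(κ/L) η_κ`, i.e. exactly the
system appearing in `WaveKineticDerivation`, and `𝔼|ŵ(t, κ)|² = (2π)⁻¹ 𝔼|û(t/(2π), κ/L)|²`.
Hence, by Theorem 1.1 and the cubic homogeneity of `𝒦`,
`𝔼|ŵ(s · (4πα²)⁻¹, κ)|² → N(s, κ/L)` uniformly, where `∂ₛN = 𝒦(N)` (`= collision N`),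
`N(0) = n_in`, `α = L^{-γ}`: in the prelude's normalisation the kinetic time is
`T_kin = (4πα²)⁻¹` — the classical `4π|T|²` prefactor of the four-wave kinetic equation
(cf. Nazarenko 2011, (6.81) and (15.2): `ṅ_k = 4π ∫ ⋯ δ(ω)` for `ω_k = k²` and unit interaction
coefficient) for `i ȧ_k = |k|² a_k + αL^{-d} ∑ ā a a`. The factor decomposes as
`2π` (Laplacian normalisation, phases `e^{2πiΩt}` versus `e^{iΩt}`) times `2` (`T_kin = 1/(2α²)`).

**Consequence.** `WaveKineticDerivation` runs the NLS clock at `kineticTime α = α⁻²` while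
comparing with solutions of `∂ₜ n = collision n` at time `t`; by the theorem the restricted mode
energies at NLS time `α⁻² t` converge to `N(4π t, ·)`, not `N(t, ·)`. Since the statement
quantifies over *all* WKE solutions with datum `n_in` and any admissible choice of good events
(`P(G_kᶜ) → 0`) has the Deng–Hani limit (uniform moment bounds of op. cit. and mass
conservation), `deng_hani_wke` is incompatible with [DengHani2026, Thm 1.1] for every datum with
`𝒦(n_in) ≢ 0`: the '?'-flagged constant is **not** harmless and is not absorbed by `δ`. The
declarations below are the corrected statements (the kinetic time and the packaged predicate;
the closed fact for `d ≥ 3`, `0 < γ < 1` is recorded in the docstring of `WaveKineticLimit`);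
`WaveKineticDerivation` and `deng_hani_wke` are left untouched (no importers use them).
Everything else (Gaussian phases, square torus, the high-probability packaging, the WKE solution
class, `δ = δ(n_in, d, γ)`) is as before and as printed in `DengHani2026`, Thm 1.1 and the
remarks following it.
-/

/-- The **kinetic (Van Hove) time in the normalisation of the prelude**
`Literature.Analysis.FluidPDE.WaveKinetic`: `T_kin(α) = (4π α²)⁻¹` for the cubic NLS
`i∂ₜw − βΔw + α_tot|w|²w = 0` on the unit torus with dispersion exactly `|κ/L|²`
(`β = (2πL)⁻²`), nonlinearity `α_tot = α L^{-d}` and `O(1)` mode energies. It is Deng–Hani's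
`T_kin = 1/(2α²)` (stated for the normalised Laplacian `(2π)⁻¹Δ`, i.e. phases `e^{2πiΩt}`)
transported to phases `e^{iΩt}`: `(2π) · 2 = 4π`, equivalently the `4π|T|²` prefactor of the
four-wave kinetic equation. With this clock the limit equation is `∂ₜ n = WaveKinetic.collision n`
with constant `1` (see the section docstring). Junk: `0⁻¹ = 0` at `α = 0`.
[cite: DengHani2026, §1.1 and Thm 1.1] -/
def dengHaniKineticTime (α : ℝ) : ℝ :=
  (4 * Real.pi * α ^ 2)⁻¹

/-- `T_kin(α) = (4π)⁻¹ · α⁻²`: the corrected kinetic time is the prelude's `kineticTime α = α⁻²`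
divided by `4π`. [folklore] -/
theorem dengHaniKineticTime_eq (α : ℝ) :
    dengHaniKineticTime α =
      (4 * Real.pi)⁻¹ * Literature.Analysis.FluidPDE.WaveKinetic.kineticTime α := by
  simp only [dengHaniKineticTime, Literature.Analysis.FluidPDE.WaveKinetic.kineticTime, mul_inv]

/-- The corrected kinetic time is nonnegative. [folklore] -/
theorem dengHaniKineticTime_nonneg (α : ℝ) : 0 ≤ dengHaniKineticTime α := by
  unfold dengHaniKineticTime
  positivity

/-- The corrected kinetic time is positive for `α ≠ 0`. [folklore] -/
theorem dengHaniKineticTime_pos {α : ℝ} (hα : α ≠ 0) : 0 < dengHaniKineticTime α := by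
  unfold dengHaniKineticTime
  have hα2 : 0 < α ^ 2 := by positivity
  positivity

/-- Under the scaling law `α = L^{-γ}`, `0 < γ`, the corrected kinetic time
`(4π)⁻¹ L^{2γ}` tends to `+∞` as `L → ∞` (Deng–Hani, Mem. AMS 1631, §1.1:
`T_kin = ½ L^{2γ} → ∞`). [folklore] -/
theorem tendsto_dengHaniKineticTime_dengHaniScalingLaw_atTop {γ : ℝ} (hγ : 0 < γ) :
    Tendsto (fun L => dengHaniKineticTime (dengHaniScalingLaw γ L)) atTop atTop := by
  simp only [dengHaniKineticTime_eq]
  exact (tendsto_kineticTime_dengHaniScalingLaw_atTop hγ).const_mul_atTop (by positivity)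

variable (d)

/-- **Deng–Hani's derivation of the wave kinetic equation (corrected clock), packaged as a
`Prop`** for the index type `d` (dimension `Fintype.card d`) and the scaling exponent `γ`.
Verbatim the statement `WaveKineticDerivation d γ` with the single change that the kinetic time
is `dengHaniKineticTime α = (4πα²)⁻¹` instead of `kineticTime α = α⁻²`, both for the NLS
existence interval `[0, δ · T_kin]` and for the comparison clock. In words: for every nonnegative
Schwartz spectrum `n_in` there is `δ = δ(n_in, d, γ) > 0` such that (i) the WKE
`∂ₜ n = collision n` with datum `n_in` has a classical solution on some `[0, T)`, `T > δ`, with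
uniform polynomial decay of every order (`DengHani2023`, Prop. 7.9: unique local solution with a
convergent Taylor expansion in the `⟨k⟩^{40d}`-weighted sup norm; decay of every order and the
classical formulation `IsWKESolutionOn` are this file's transcription, as in
`WaveKineticDerivation`, not printed verbatim), and
(ii) for every probability space, Gaussian random phase family `η` and box sizes `L_k → +∞`
there are measurable good events `G_k`, `P(G_kᶜ) → 0` (printed: `≥ 1 − e^{−(log L)²}` for `L`
large; `G_k = ∅` is allowed for the finitely many small `L_k`), and fields `u_k(ω)` solving, for
`ω ∈ G_k`, the rescaled cubic NLS `i∂ₜu − (2πL_k)⁻²Δu + L_k^{-γ} L_k^{-d}|u|²u = 0` smoothly on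
`[0, δ · T_kin]`, `T_kin = (4π L_k^{-2γ})⁻¹`, with data `randomData L_k n_in η ω` and
`ω`-measurable Fourier modes, such that for every WKE solution `n` in the class of (i) with
`n(0) = n_in`,
`sup_{t ∈ [0, δ]} sup_{κ ∈ ℤ^d} |𝔼(1_{G_k} |û_k(T_kin t, κ)|²) − n(t, κ/L_k)| → 0`.
This is [DengHani2026, Thm 1.1] (square torus, `d ≥ 3`, `0 < γ < 1`, Gaussian data,
`δ = δ(d, γ, n_in)`) transported to the unit torus by `w(t, y) = (2π)^{-1/2} L^{d/2} u(t/(2π), Ly)`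
and datum `2π n_in` (section docstring). Not recorded: the rate `e^{−(log L)²}`, the convergence
rate `L^{-c}`, non-Gaussian phases, rectangular tori. The printed theorem asserts
`WaveKineticLimit d γ` exactly for `3 ≤ Fintype.card d` and `γ ∈ Ioo 0 1`; the corresponding
closed named fact `∀ (hd : 3 ≤ Fintype.card d) {γ} (hγ : γ ∈ Ioo 0 1), WaveKineticLimit d γ`
(the corrected `deng_hani_wke`) is deliberately *not* declared in this change (fact-debt
discipline D-0026; it is to be filed through the operator path and should replace
`deng_hani_wke`). [cite: DengHani2026, Thm 1.1] -/
def WaveKineticLimit (γ : ℝ) : Prop :=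
  ∀ nin : SchwartzMap (EuclideanSpace ℝ d) ℝ, (∀ v, 0 ≤ nin v) →
    ∃ δ : ℝ, 0 < δ ∧
      (∃ (T : ℝ) (n : ℝ → EuclideanSpace ℝ d → ℝ), δ < T ∧ Literature.Analysis.FluidPDE.WaveKinetic.IsWKESolutionOn T n ∧
        (∀ s : ℝ, Literature.Analysis.FluidPDE.WaveKinetic.HasUniformDecayOn T s n) ∧ n 0 = nin) ∧
      ∀ (Ω : Type u) [MeasurableSpace Ω] (P : Measure Ω) [IsProbabilityMeasure P]
        (η : (d → ℤ) → Ω → ℂ), Literature.Analysis.FluidPDE.WaveKinetic.IsGaussianPhaseFamily P η →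
      ∀ L : ℕ → ℝ, (∀ k, 0 < L k) → Tendsto L atTop atTop →
      ∃ (G : ℕ → Set Ω) (u : ℕ → Ω → ℝ → UnitAddTorus d → ℂ),
        (∀ k, MeasurableSet (G k)) ∧
        Tendsto (fun k => P (G k)ᶜ) atTop (𝓝 0) ∧
        (∀ k, ∀ ω ∈ G k, Literature.Analysis.FluidPDE.WaveKinetic.IsCubicNLSOn
            (Icc 0 (δ * dengHaniKineticTime (dengHaniScalingLaw γ (L k))))
            (((2 * Real.pi * L k) ^ 2)⁻¹)
            (dengHaniScalingLaw γ (L k) / L k ^ Fintype.card d) (u k ω) ∧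
          u k ω 0 = Literature.Analysis.FluidPDE.WaveKinetic.randomData (L k) nin η ω) ∧
        (∀ k, ∀ t ∈ Icc 0 (δ * dengHaniKineticTime (dengHaniScalingLaw γ (L k))), ∀ κ,
          Measurable fun ω => UnitAddTorus.mFourierCoeff (u k ω t) κ) ∧
      ∀ (T : ℝ) (n : ℝ → EuclideanSpace ℝ d → ℝ), δ < T →
        Literature.Analysis.FluidPDE.WaveKinetic.IsWKESolutionOn T n → (∀ s : ℝ, Literature.Analysis.FluidPDE.WaveKinetic.HasUniformDecayOn T s n) →
        n 0 = nin →
      Tendsto (fun k => ⨆ t ∈ Icc (0 : ℝ) δ, ⨆ κ : d → ℤ,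
          ENNReal.ofReal |Literature.Analysis.FluidPDE.WaveKinetic.modeEnergy (P.restrict (G k)) (u k)
              (dengHaniKineticTime (dengHaniScalingLaw γ (L k)) * t) κ -
            n t ((L k)⁻¹ • Literature.Analysis.FunctionSpaces.Torus.latticeVec κ)|)
        atTop (𝓝 0)

variable {d}

/-- API / projection (i) of the corrected package: `WaveKineticLimit d γ` contains the local
solvability of the wave kinetic equation `∂ₜ n = collision n` for every nonnegative Schwartz
datum, in the weighted-`L^∞` class of every order (cf. the named fact
`WaveKinetic.exists_isWKESolutionOn_local`, which is this statement for a general Euclidean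
space of dimension `≥ 3`). [folklore] -/
theorem WaveKineticLimit.exists_isWKESolutionOn {γ : ℝ} (h : WaveKineticLimit.{u} d γ)
    (nin : SchwartzMap (EuclideanSpace ℝ d) ℝ) (hnin : ∀ v, 0 ≤ nin v) :
    ∃ T : ℝ, 0 < T ∧ ∃ n : ℝ → EuclideanSpace ℝ d → ℝ, n 0 = nin ∧
      Literature.Analysis.FluidPDE.WaveKinetic.IsWKESolutionOn T n ∧
      ∀ s : ℝ, Literature.Analysis.FluidPDE.WaveKinetic.HasUniformDecayOn T s n := by
  obtain ⟨δ, hδ, ⟨T, n, hT, hsol, hdec, h0⟩, -⟩ := h nin hnin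
  exact ⟨T, hδ.trans hT, n, h0, hsol, hdec⟩

end Hilbert6

end

end Literature.MathematicalPhysics.KineticTheory
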